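import Summits.CriticalPhenomena.PercolationContinuityZ3.Theses.PercNonProliferation
import Summits.CriticalPhenomena.PercolationContinuityZ3.Theses.PercBudgetLadder
import Summits.CriticalPhenomena.PercolationContinuityZ3.Theorems.PercNonProliferationNonProliferationRatioDichotomy
import HarnessLib

/-!
# Crux `PercNonProliferation.NonProliferation` (stmt-CriticalPhenomena-4444), line `jump-fragmentation` —
# stub `stub_contSureResidue` (S3, the continuous sure-crossing residue): VACUOUS CERTIFICATE, parked

Line `jump-fragmentation` (skeleton `Cruxes/NonProliferation/Lines/jump_fragmentation.lean`, lead c8) re-cuts the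
crux (at `p_c(ℤ³)`, for some `M`, `c > 0` and infinitely many `n`, with probability `≥ c` at most `M` clusters of the
open graph induced on `B(2n)` join `B(n)` to `∂ⁱⁿB(2n)`) along INFINITE (S1) / FINITE (S2) / CONTINUOUS (S3), by
cases on `θ(p_c) = 0`. In the continuous case, if the crux failed, the landed ratio dichotomy
`crossing_tendsto_one_of_not_nonProliferation` gives sure crossing of the critical annulus `B(m) → ∂ⁱⁿB(km)` inside
`B(km)` at EVERY ratio `k ≥ 2`, and S3 = `stub_contSureResidue` (`θ(p_c) = 0 →` sure crossing at every ratio `→`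
the crux, spelled out) returns the crux. S3 is the crux's entire `d = 3` / hyperscaling content: non-vacuously it
is an OPEN PROBLEM (both hypotheses hold and the conclusion fails for `d ≥ 7` under Aizenman's two-point
condition), and every earlier line of this crux died attacking exactly it. It is NOT attacked here.

What this file records (lands `--supports stmt-CriticalPhenomena-4444`; **closes nothing by itself**): S3 is
VACUOUSLY implied by the open target `PercBudgetLadder.CritAnnulusBlockedIO` (stmt-CriticalPhenomena-5247) —
blocking of `B(n) → ∂ⁱⁿB(l n)` with probability `≥ c > 0` for infinitely many `n` at one ratio `l ≥ 2` contradicts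
sure crossing at ratio `l`, so under 5247 the hypotheses of S3 are inconsistent
(`contSureResidue_of_critAnnulusBlockedIO`). Hence S3 closes for free the day 5247 closes; and 5247 closes the
summit by itself (`PercBudgetLadder.SufficesTarget`), so this certificate does not make the crux easier — it is
the honest label "parked residue" on S3. (Same argument as the sibling certificate
`contSureNonProliferation_of_critAnnulusBlockedIO` of the split `JumpContinuousSplit`, whose conclusion is the crux
BY NAME; here the conclusion is the verbatim signature of the registered stub `stub_contSureResidue`, so that the
skeleton's S3 slot is served literally.)
-/

noncomputable section

namespace Summit.CriticalPhenomena.PercolationContinuityZ3.Theorems.NonProliferation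

open MeasureTheory Filter Topology
open Literature.Probability.LatticeModels Literature.Probability.Percolation

/-- **S3 (`stub_contSureResidue`) is dominated by the target of route `PercBudgetLadder`
(stmt-CriticalPhenomena-5247), vacuously:** `CritAnnulusBlockedIO →` (`θ(p_c(ℤ³)) = 0 →` sure crossing of the
critical annulus at every ratio `k ≥ 2` `→` the crux, spelled out). Blocking of `B(n) → ∂ⁱⁿB(l n)` inside
`B(l n)` with probability `≥ c > 0` for infinitely many `n` at one ratio `l ≥ 2` contradicts sure crossing at
ratio `l`: eventually the crossing probability exceeds `1 - c`, while the blocked event is the complement of the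
crossing event (`RatioDichotomy.measurableSet_crossing`, `probReal_compl_eq_one_sub`). Parked residue; closes
nothing by itself. -/
theorem contSureResidue_of_critAnnulusBlockedIO :
    Summit.CriticalPhenomena.PercolationContinuityZ3.Theses.PercBudgetLadder.CritAnnulusBlockedIO →
    theta (zdGraph 3) (0 : Site 3) (criticalProbI 3) = 0 →
    (∀ k : ℕ, 2 ≤ k → Tendsto (fun m : ℕ => (bondPercolation (zdGraph 3) (criticalProbI 3)).real
      {ω | ∃ x ∈ box 3 m, ∃ y ∈ innerBoundary (zdGraph 3) (box 3 (k * m)),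
        ω ∈ openConnIn (↑(box 3 (k * m)) : Set (Site 3)) x y}) atTop (𝓝 1)) →
    ∃ (M : ℕ) (c : ℝ), 0 < c ∧ ∃ᶠ n : ℕ in atTop, c ≤ (bondPercolation (zdGraph 3) (criticalProbI 3)).real
      {ω | ¬ ∃ x : Fin (M + 1) → Site 3, (∀ i, x i ∈ box 3 n) ∧
        (∀ i, ∃ y ∈ innerBoundary (zdGraph 3) (box 3 (2 * n)),
          ω ∈ openConnIn (↑(box 3 (2 * n)) : Set (Site 3)) (x i) y) ∧
        ∀ i j, i ≠ j → ω ∉ openConnIn (↑(box 3 (2 * n)) : Set (Site 3)) (x i) (x j)} := by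
  intro h _ hsure
  obtain ⟨l, c, hl, hc, hio⟩ := h
  exfalso
  set μ : Measure (BondConfig (Site 3)) := bondPercolation (zdGraph 3) (criticalProbI 3) with hμ
  -- sure crossing at ratio `l`: eventually the crossing probability exceeds `1 - c`
  have hev := (tendsto_order.1 (hsure l hl)).1 (1 - c) (by linarith)
  obtain ⟨N, hN⟩ := eventually_atTop.1 hev
  -- a blocked scale `n ≥ N` from 5247
  obtain ⟨n, hNn, hblock⟩ := hio N
  have hlt := hN n hNn
  -- the blocked event is the complement of the crossing event
  have hcompl : μ.real {ω | ¬ ∃ x ∈ box 3 n, ∃ y ∈ innerBoundary (zdGraph 3) (box 3 (l * n)),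
        ω ∈ openConnIn (↑(box 3 (l * n)) : Set (Site 3)) x y} =
      1 - μ.real {ω | ∃ x ∈ box 3 n, ∃ y ∈ innerBoundary (zdGraph 3) (box 3 (l * n)),
        ω ∈ openConnIn (↑(box 3 (l * n)) : Set (Site 3)) x y} := by
    rw [show {ω : BondConfig (Site 3) | ¬ ∃ x ∈ box 3 n, ∃ y ∈ innerBoundary (zdGraph 3) (box 3 (l * n)),
          ω ∈ openConnIn (↑(box 3 (l * n)) : Set (Site 3)) x y} =
        {ω : BondConfig (Site 3) | ∃ x ∈ box 3 n, ∃ y ∈ innerBoundary (zdGraph 3) (box 3 (l * n)),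
          ω ∈ openConnIn (↑(box 3 (l * n)) : Set (Site 3)) x y}ᶜ from rfl]
    exact probReal_compl_eq_one_sub (RatioDichotomy.measurableSet_crossing 3 n (l * n))
  have hblock' : c ≤ 1 - μ.real {ω | ∃ x ∈ box 3 n, ∃ y ∈ innerBoundary (zdGraph 3) (box 3 (l * n)),
        ω ∈ openConnIn (↑(box 3 (l * n)) : Set (Site 3)) x y} := by
    rw [← hcompl]; exact hblock
  linarith

end Summit.CriticalPhenomena.PercolationContinuityZ3.Theorems.NonProliferation

end
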